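import Summits.QuantumFields.YangMills.Theorems.UnitScaleTiltSmoothLiftLoopSplit
import Literature.MathematicalPhysics.QuantumFieldTheory.Balaban1983to89.LatticeWordStokes
import HarnessLib

/-!
# Route `UnitScaleTilt`, crux K1 child «MinimiserStabilityRegPr» (stmt-QuantumFields-19200), stub `stub_smoothLift` (G-K1a-2′) — helper P3c:
# THE FIRST-ORDER PART OF THE LOOP VARIABLES OF THE SMOOTH INTERPOLATION, AND ITS CANCELLATION OVER THE INDEX SET OF (0.4)

Fleet seat `ym-ust-19200-p2` (gen 0).  By `UnitScaleTiltSmoothLiftLoopSplit.coe_loopHol_interp` every loop variable of (0.4) of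
`W = interp V` at `c = ⟨y, y+e_μ⟩`, index `(n, σ, σ′)`, is `Π_k exp X_k` for an explicit list.  Here:
* §1 **`sum_loopExps_eq`** — the sum of that list is `MAIN + ERR` with
  `MAIN = S(σ,n) − S(σ′,n) + 2L·potAt F n μ`, `S(σ,n) = Σ stepExps F 0 Γ^σ_n`, `F = curv V y` (the segments along `e_μ` contribute
  `(h − n_μ) + (L+1) + (n_μ + h) = 2L` copies of `potAt F n μ`, the reversed staircase contributes `−S` read with the transported tensor
  `F″ = V(c)F(y+e_μ)V(c)*`, the two axis runs contribute `0`), and `‖ERR‖ ≤ d²·b′` from `‖F″ − F‖ ≤ b′` (covariant constancy);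
* §2 **`sum_main_eq_zero`** — `Σ_{(n,σ,σ′)} MAIN = 0`: the staircase sums cancel under `σ ↔ σ′`, and `Σ_n n_ρ = 0` over the centred cube
  (the involution `revAt ρ` of `BlockAveraging`), so the linear potential averages to zero.
This is the exact first-order vanishing of `log corr(c)` for the interpolation — the mechanism of the consistency
`‖V(c) − avg(interp V)(c)‖ = O(|F|² + |∇F|)` (next file). [cite: Balaban1987RG1, (0.4) p.253; King1986, (A.5) p.676]
-/

noncomputable section

open scoped Matrix.Norms.L2Operator BigOperators

namespace Summit.QuantumFields.YangMills.Theorems.SmoothLiftInterp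

open Literature.MathematicalPhysics.QuantumFieldTheory.Balaban1983to89
open MatrixLog T4Continuum AveragingRT BlockAveraging BlockAveragingSection BlockAveragingSectionPlaq NormedSpace

variable {P : Params} {j : ℕ}

/-! ## §1 The sum of the exponents: main term and error -/

section Sums

variable (P) in
/-- The `μ`-potential does not depend on the `μ`-coordinate of the offset (`F_{μμ} = 0`). [folklore] -/
theorem potAt_update_self (F : Fin P.d → Fin P.d → Matrix (Fin 2) (Fin 2) ℂ) {μ : Fin P.d} (hF : F μ μ = 0) (e : Fin P.d → ℤ) (v : ℤ) :
    potAt P F (Function.update e μ v) μ = potAt P F e μ := by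
  unfold potAt
  congr 1
  refine Finset.sum_congr rfl fun ρ _ => ?_
  by_cases h : ρ = μ
  · subst h; rw [hF, smul_zero, smul_zero]
  · rw [Function.update_of_ne h]

variable (P) in
/-- The potential at the centre is `0`. [folklore] -/
theorem potAt_zero (F : Fin P.d → Fin P.d → Matrix (Fin 2) (Fin 2) ℂ) (μ : Fin P.d) : potAt P F 0 μ = 0 := by
  unfold potAt; simp

variable (P) in
/-- The potential read with two curvature tensors differs by `≤ d·M·δ/(2L²)` at an offset of size `≤ M`. [folklore] -/
theorem norm_potAt_sub_le (F F' : Fin P.d → Fin P.d → Matrix (Fin 2) (Fin 2) ℂ) {δ M : ℝ} (hM : 0 ≤ M)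
    (hδ : ∀ ρ μ, ‖F ρ μ - F' ρ μ‖ ≤ δ) {e : Fin P.d → ℤ} (he : ∀ ν, |((e ν : ℤ) : ℝ)| ≤ M) (μ : Fin P.d) :
    ‖potAt P F e μ - potAt P F' e μ‖ ≤ (P.d : ℝ) * M * δ / (2 * (P.L : ℝ) ^ 2) := by
  unfold potAt
  rw [← smul_sub, ← Finset.sum_sub_distrib, norm_smul, Real.norm_of_nonneg (by positivity)]
  have hs : ‖∑ ρ : Fin P.d, (((e ρ : ℤ) : ℝ) • F ρ μ - ((e ρ : ℤ) : ℝ) • F' ρ μ)‖ ≤ (P.d : ℝ) * (M * δ) := by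
    calc _ ≤ ∑ ρ : Fin P.d, ‖((e ρ : ℤ) : ℝ) • F ρ μ - ((e ρ : ℤ) : ℝ) • F' ρ μ‖ := norm_sum_le _ _
      _ ≤ ∑ _ρ : Fin P.d, M * δ := Finset.sum_le_sum fun ρ _ => by
          rw [← smul_sub, norm_smul, Real.norm_eq_abs]
          exact mul_le_mul (he ρ) (hδ ρ μ) (norm_nonneg _) hM
      _ = (P.d : ℝ) * (M * δ) := by rw [Finset.sum_const, Finset.card_univ, Fintype.card_fin, nsmul_eq_mul]
  calc 1 / (2 * (P.L : ℝ) ^ 2) * ‖∑ ρ : Fin P.d, (((e ρ : ℤ) : ℝ) • F ρ μ - ((e ρ : ℤ) : ℝ) • F' ρ μ)‖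
      ≤ 1 / (2 * (P.L : ℝ) ^ 2) * ((P.d : ℝ) * (M * δ)) := by gcongr
    _ = _ := by ring

variable (P) in
/-- The staircase sum read with two curvature tensors differs by `≤ (d·h)·(d·h·δ)/(2L²)` when the tensors differ by `≤ δ`
(`h = (L−1)/2`). [folklore] -/
theorem norm_stairSum_sub_le (F F' : Fin P.d → Fin P.d → Matrix (Fin 2) (Fin 2) ℂ) {δ : ℝ} (hδ : ∀ ρ μ, ‖F ρ μ - F' ρ μ‖ ≤ δ)
    (σ : Equiv.Perm (Fin P.d)) (r : Fin P.d → Fin P.L) :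
    ‖(stepExps P F 0 (stairWord σ (off r))).sum - (stepExps P F' 0 (stairWord σ (off r))).sum‖ ≤
      ((P.d : ℝ) * (((P.L - 1) / 2 : ℕ) : ℝ)) * ((P.d : ℝ) * (((P.L - 1) / 2 : ℕ) : ℝ) * δ / (2 * (P.L : ℝ) ^ 2)) := by
  have hlen : ((stairWord σ (off r)).length : ℝ) ≤ (P.d : ℝ) * (((P.L - 1) / 2 : ℕ) : ℝ) := by
    have h := LatticeWordStokes.length_stairWord_le σ (off r) ((P.L - 1) / 2) (fun ν => by have := off_bounds r ν; omega)
    exact_mod_cast h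
  have hbox : ∀ (k : ℕ) (ν : Fin P.d), |(((0 : Fin P.d → ℤ) ν + netDisp ((stairWord σ (off r)).take k) ν : ℤ) : ℝ)| ≤ (((P.L - 1) / 2 : ℕ) : ℝ) := by
    intro k ν
    have h := box_stairWord σ r k ν
    simp only [Pi.zero_apply, zero_add] at h ⊢
    have h1 : ((netDisp ((stairWord σ (off r)).take k) ν : ℤ) : ℝ) ≤ ((((P.L - 1) / 2 : ℕ) : ℤ) : ℝ) := by exact_mod_cast h.2
    have h2 : ((-(((P.L - 1) / 2 : ℕ) : ℤ) : ℤ) : ℝ) ≤ ((netDisp ((stairWord σ (off r)).take k) ν : ℤ) : ℝ) := by exact_mod_cast h.1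
    rw [Int.cast_natCast] at h1; rw [Int.cast_neg, Int.cast_natCast] at h2
    rw [abs_le]; exact ⟨h2, h1⟩
  have hδ0 : 0 ≤ δ := (norm_nonneg _).trans (hδ ⟨0, P.hd⟩ ⟨0, P.hd⟩)
  refine (norm_sum_stepExps_sub_le P F F' (by positivity) hδ _ _ hbox).trans ?_
  exact mul_le_mul_of_nonneg_right hlen (by positivity)

/-- **THE SUM OF THE EXPONENTS OF A LOOP**: `Σ_k X_k = S(F,σ,n) − S(F,σ′,n) + 2L·potAt F n μ + ERR`, `‖ERR‖ ≤ d²·b′`, where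
`S(F,σ,n) = Σ stepExps F 0 Γ^σ_n` and `b′` bounds `‖V(c)F(y+e_μ)V(c)* − F(y)‖`. [cite: Balaban1987RG1, (0.4) p.253] -/
theorem sum_loopExps_eq (V : GaugeField P (j+1) (Matrix.specialUnitaryGroup (Fin 2) ℂ)) (y : Site P (j+1)) (μ : Fin P.d)
    (r : Fin P.d → Fin P.L) (σ σ' : Equiv.Perm (Fin P.d)) {b' : ℝ}
    (hcc : ∀ ρ ν : Fin P.d, ‖((V ⟨y, μ⟩ : Matrix.specialUnitaryGroup (Fin 2) ℂ) : Matrix (Fin 2) (Fin 2) ℂ) * curv V (y.shift μ) ρ ν *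
        star ((V ⟨y, μ⟩ : Matrix.specialUnitaryGroup (Fin 2) ℂ) : Matrix (Fin 2) (Fin 2) ℂ) - curv V y ρ ν‖ ≤ b') :
    ∃ E : Matrix (Fin 2) (Fin 2) ℂ,
      (stepExps P (curv V y) 0 (stairWord σ (off r)) ++
        (stepExps P (curv V y) (off r) (List.replicate ((((P.L - 1) / 2 : ℕ) : ℤ) - off r μ).toNat (μ, true)) ++
        ([((P.L : ℝ) + 1) • potAt P (curv V y) (Function.update (off r) μ (((P.L - 1) / 2 : ℕ) : ℤ)) μ] ++
        (stepExps P (fun ρ ν => ((V ⟨y, μ⟩ : Matrix.specialUnitaryGroup (Fin 2) ℂ) : Matrix (Fin 2) (Fin 2) ℂ) * curv V (y.shift μ) ρ ν *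
            star ((V ⟨y, μ⟩ : Matrix.specialUnitaryGroup (Fin 2) ℂ) : Matrix (Fin 2) (Fin 2) ℂ))
            (Function.update (off r) μ (-(((P.L - 1) / 2 : ℕ) : ℤ))) (List.replicate (off r μ + (((P.L - 1) / 2 : ℕ) : ℤ)).toNat (μ, true)) ++
        (stepExps P (fun ρ ν => ((V ⟨y, μ⟩ : Matrix.specialUnitaryGroup (Fin 2) ℂ) : Matrix (Fin 2) (Fin 2) ℂ) * curv V (y.shift μ) ρ ν *
            star ((V ⟨y, μ⟩ : Matrix.specialUnitaryGroup (Fin 2) ℂ) : Matrix (Fin 2) (Fin 2) ℂ))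
            (off r) (wordRev (stairWord σ' (off r))) ++
        (stepExps P (fun ρ ν => ((V ⟨y, μ⟩ : Matrix.specialUnitaryGroup (Fin 2) ℂ) : Matrix (Fin 2) (Fin 2) ℂ) * curv V (y.shift μ) ρ ν *
            star ((V ⟨y, μ⟩ : Matrix.specialUnitaryGroup (Fin 2) ℂ) : Matrix (Fin 2) (Fin 2) ℂ))
            0 (List.replicate ((P.L - 1) / 2) (μ, false)) ++
        stepExps P (curv V y) (Function.update (0 : Fin P.d → ℤ) μ (((P.L - 1) / 2 : ℕ) : ℤ)) (List.replicate ((P.L - 1) / 2) (μ, false)))))))).sum =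
      ((stepExps P (curv V y) 0 (stairWord σ (off r))).sum - (stepExps P (curv V y) 0 (stairWord σ' (off r))).sum +
        (2 * (P.L : ℝ)) • potAt P (curv V y) (off r) μ) + E ∧ ‖E‖ ≤ (P.d : ℝ) ^ 2 * b' := by
  -- names
  set hh : ℕ := (P.L - 1) / 2 with hhh
  have hL : P.L = 2 * hh + 1 := (two_mul_half_add_one P).symm
  have hLr : (P.L : ℝ) = 2 * hh + 1 := by exact_mod_cast hL
  set n : Fin P.d → ℤ := off r with hn
  have hnb : ∀ ν, -(hh : ℤ) ≤ n ν ∧ n ν ≤ (hh : ℤ) := fun ν => off_bounds r ν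
  set F := curv V y with hF
  set U : Matrix (Fin 2) (Fin 2) ℂ := ((V ⟨y, μ⟩ : Matrix.specialUnitaryGroup (Fin 2) ℂ) : Matrix (Fin 2) (Fin 2) ℂ) with hU
  set F'' : Fin P.d → Fin P.d → Matrix (Fin 2) (Fin 2) ℂ := fun ρ ν => U * curv V (y.shift μ) ρ ν * star U with hF''
  have hFμ : F μ μ = 0 := curv_self V y μ
  have hF''μ : F'' μ μ = 0 := by simp only [hF'', curv_self, mul_zero, zero_mul]
  set t₁ : ℕ := ((hh : ℤ) - n μ).toNat with ht₁
  set t₂ : ℕ := (n μ + (hh : ℤ)).toNat with ht₂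
  have ht₁' : (t₁ : ℝ) = hh - (n μ : ℝ) := by
    have : (t₁ : ℤ) = hh - n μ := by rw [ht₁]; have := hnb μ; omega
    exact_mod_cast this
  have ht₂' : (t₂ : ℝ) = (n μ : ℝ) + hh := by
    have : (t₂ : ℤ) = n μ + hh := by rw [ht₂]; have := hnb μ; omega
    exact_mod_cast this
  set β := potAt P F n μ with hβ
  set β'' := potAt P F'' n μ with hβ''
  -- the seven partial sums
  have s2 : (stepExps P F n (List.replicate t₁ (μ, true))).sum = (t₁ : ℝ) • β := sum_stepExps_replicate_true P F hFμ t₁ n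
  have s3 : potAt P F (Function.update n μ (hh : ℤ)) μ = β := potAt_update_self P F hFμ n _
  have s4 : (stepExps P F'' (Function.update n μ (-(hh : ℤ))) (List.replicate t₂ (μ, true))).sum = (t₂ : ℝ) • β'' := by
    rw [sum_stepExps_replicate_true P F'' hF''μ t₂, potAt_update_self P F'' hF''μ]
  have s5 : (stepExps P F'' n (wordRev (stairWord σ' n))).sum = -(stepExps P F'' 0 (stairWord σ' n)).sum := by
    have h := sum_stepExps_wordRev P F'' (stairWord σ' n) 0
    have h0 : ((0 : Fin P.d → ℤ) + fun ν => netDisp (stairWord σ' n) ν) = n := by funext ν; simp [netDisp_stairWord]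
    rwa [h0] at h
  have s6 : (stepExps P F'' 0 (List.replicate hh (μ, false))).sum = 0 := by
    rw [sum_stepExps_replicate_false P F'' hF''μ, potAt_zero, smul_zero, neg_zero]
  have s7 : (stepExps P F (Function.update (0 : Fin P.d → ℤ) μ (hh : ℤ)) (List.replicate hh (μ, false))).sum = 0 := by
    rw [sum_stepExps_replicate_false P F hFμ, potAt_update_self P F hFμ, potAt_zero, smul_zero, neg_zero]
  -- the error
  set E : Matrix (Fin 2) (Fin 2) ℂ := (t₂ : ℝ) • (β'' - β) - ((stepExps P F'' 0 (stairWord σ' n)).sum - (stepExps P F 0 (stairWord σ' n)).sum) with hE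
  refine ⟨E, ?_, ?_⟩
  · simp only [List.sum_append, List.sum_cons, List.sum_nil, add_zero, s2, s3, s4, s5, s6, s7]
    rw [hE, hLr, ht₁', ht₂']
    module
  · -- `‖E‖ ≤ t₂·(d h b′/(2L²)) + (d h)·(d h b′/(2L²)) ≤ d² b′`
    have hL0 : (0 : ℝ) < P.L := Nat.cast_pos.mpr P.L_pos
    have hd1 : (1 : ℝ) ≤ P.d := by exact_mod_cast P.hd
    have hb0 : 0 ≤ b' := (norm_nonneg _).trans (hcc μ μ)
    have hhL : (hh : ℝ) ≤ (P.L : ℝ) / 2 := by rw [hLr]; linarith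
    have hh0 : (0 : ℝ) ≤ hh := Nat.cast_nonneg _
    have hδ : ∀ ρ ν, ‖F'' ρ ν - F ρ ν‖ ≤ b' := fun ρ ν => hcc ρ ν
    have hnabs : ∀ ν, |((n ν : ℤ) : ℝ)| ≤ (hh : ℝ) := fun ν => by
      have h := hnb ν
      have h1 : ((n ν : ℤ) : ℝ) ≤ (((hh : ℕ) : ℤ) : ℝ) := by exact_mod_cast h.2
      have h2 : ((-((hh : ℕ) : ℤ) : ℤ) : ℝ) ≤ ((n ν : ℤ) : ℝ) := by exact_mod_cast h.1
      rw [Int.cast_natCast] at h1; rw [Int.cast_neg, Int.cast_natCast] at h2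
      rw [abs_le]; exact ⟨h2, h1⟩
    have hβd : ‖β'' - β‖ ≤ (P.d : ℝ) * hh * b' / (2 * (P.L : ℝ) ^ 2) := norm_potAt_sub_le P F'' F hh0 hδ hnabs μ
    have hS : ‖(stepExps P F'' 0 (stairWord σ' n)).sum - (stepExps P F 0 (stairWord σ' n)).sum‖ ≤
        ((P.d : ℝ) * hh) * ((P.d : ℝ) * hh * b' / (2 * (P.L : ℝ) ^ 2)) := norm_stairSum_sub_le P F'' F hδ σ' r
    have ht₂b : (t₂ : ℝ) ≤ 2 * hh := by
      have h2 : (t₂ : ℤ) ≤ 2 * hh := by rw [ht₂]; have := hnb μ; omega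
      exact_mod_cast h2
    have ht₂0 : (0 : ℝ) ≤ t₂ := Nat.cast_nonneg _
    calc ‖E‖ ≤ ‖(t₂ : ℝ) • (β'' - β)‖ + ‖(stepExps P F'' 0 (stairWord σ' n)).sum - (stepExps P F 0 (stairWord σ' n)).sum‖ := norm_sub_le _ _
      _ ≤ (2 * hh) * ((P.d : ℝ) * hh * b' / (2 * (P.L : ℝ) ^ 2)) + ((P.d : ℝ) * hh) * ((P.d : ℝ) * hh * b' / (2 * (P.L : ℝ) ^ 2)) := by
          rw [norm_smul, Real.norm_of_nonneg ht₂0]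
          exact add_le_add (mul_le_mul ht₂b hβd (norm_nonneg _) (by positivity)) hS
      _ = (P.d : ℝ) * b' * (2 + (P.d : ℝ)) / 8 * ((2 * (hh : ℝ)) ^ 2 / (P.L : ℝ) ^ 2) := by
          field_simp; ring
      _ ≤ (P.d : ℝ) * b' * (2 + (P.d : ℝ)) / 8 * 1 := by
          gcongr
          rw [div_le_one (by positivity)]; nlinarith
      _ ≤ (P.d : ℝ) ^ 2 * b' := by
          have h7 : 0 ≤ (P.d : ℝ) * b' * (7 * (P.d : ℝ) - 2) := mul_nonneg (mul_nonneg (by linarith) hb0) (by linarith)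
          nlinarith [h7]

end Sums

/-! ## §2 The main term averages to zero over the index set of (0.4) -/

section Cancellation

/-- **THE CENTRED OFFSETS SUM TO ZERO**: `Σ_{r} n_ρ(r) = 0` over the cube `{0,…,L−1}^d` (the involution `r_ρ ↦ L−1−r_ρ`). [folklore] -/
theorem sum_off_eq_zero (ρ : Fin P.d) : ∑ r : Fin P.d → Fin P.L, ((off r ρ : ℤ) : ℝ) = 0 := by
  set e : (Fin P.d → Fin P.L) ≃ (Fin P.d → Fin P.L) := ⟨revAt ρ, revAt ρ, revAt_revAt ρ, revAt_revAt ρ⟩ with he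
  have h : ∑ r : Fin P.d → Fin P.L, ((off r ρ : ℤ) : ℝ) = ∑ r : Fin P.d → Fin P.L, ((off (revAt ρ r) ρ : ℤ) : ℝ) :=
    (Equiv.sum_comp e (fun r => ((off r ρ : ℤ) : ℝ))).symm
  have h2 : ∀ r : Fin P.d → Fin P.L, ((off (revAt ρ r) ρ : ℤ) : ℝ) = -((off r ρ : ℤ) : ℝ) := fun r => by
    rw [off_revAt]; simp [negAt]
  simp_rw [h2, Finset.sum_neg_distrib] at h
  linarith

variable (P) in
/-- The linear potential averages to zero over the block: `Σ_r potAt F (n(r)) μ = 0`. [folklore] -/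
theorem sum_potAt_off_eq_zero (F : Fin P.d → Fin P.d → Matrix (Fin 2) (Fin 2) ℂ) (μ : Fin P.d) :
    ∑ r : Fin P.d → Fin P.L, potAt P F (off r) μ = 0 := by
  unfold potAt
  rw [← Finset.smul_sum, Finset.sum_comm]
  have h : ∀ ρ : Fin P.d, ∑ r : Fin P.d → Fin P.L, ((off r ρ : ℤ) : ℝ) • F ρ μ = 0 := fun ρ => by
    rw [← Finset.sum_smul, sum_off_eq_zero, zero_smul]
  simp_rw [h, Finset.sum_const_zero, smul_zero]

variable (P) in
/-- **THE MAIN TERM AVERAGES TO ZERO**: `Σ_{(r,σ,σ′)} [S(σ,n(r)) − S(σ′,n(r)) + 2L·potAt F n(r) μ] = 0` — the staircase sums cancel under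
`σ ↔ σ′` and the linear potential averages to zero over the centred block. [cite: Balaban1987RG1, (0.4) p.253] -/
theorem sum_main_eq_zero (F : Fin P.d → Fin P.d → Matrix (Fin 2) (Fin 2) ℂ) (μ : Fin P.d) :
    ∑ i : Idx P, ((stepExps P F 0 (stairWord i.2.1 (off i.1))).sum - (stepExps P F 0 (stairWord i.2.2 (off i.1))).sum +
      (2 * (P.L : ℝ)) • potAt P F (off i.1) μ) = 0 := by
  rw [Fintype.sum_prod_type]
  simp only [Fintype.sum_prod_type]
  have h1 : ∀ r : Fin P.d → Fin P.L,
      ∑ σ : Equiv.Perm (Fin P.d), ∑ σ' : Equiv.Perm (Fin P.d),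
        ((stepExps P F 0 (stairWord σ (off r))).sum - (stepExps P F 0 (stairWord σ' (off r))).sum + (2 * (P.L : ℝ)) • potAt P F (off r) μ) =
        (Fintype.card (Equiv.Perm (Fin P.d)) * Fintype.card (Equiv.Perm (Fin P.d))) • ((2 * (P.L : ℝ)) • potAt P F (off r) μ) := by
    intro r
    have hc : ∑ σ : Equiv.Perm (Fin P.d), ∑ σ' : Equiv.Perm (Fin P.d), (stepExps P F 0 (stairWord σ (off r))).sum =
        ∑ σ : Equiv.Perm (Fin P.d), ∑ σ' : Equiv.Perm (Fin P.d), (stepExps P F 0 (stairWord σ' (off r))).sum := Finset.sum_comm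
    simp only [Finset.sum_add_distrib, Finset.sum_sub_distrib]
    rw [hc, sub_self, zero_add, Finset.sum_const, Finset.sum_const, Finset.card_univ, smul_smul]
  rw [Finset.sum_congr rfl fun r _ => h1 r, ← Finset.smul_sum, ← Finset.smul_sum, sum_potAt_off_eq_zero, smul_zero, smul_zero]

end Cancellation


end Summit.QuantumFields.YangMills.Theorems.SmoothLiftInterp

end
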